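import Mathlib
import Summits.ValiantsHypothesis.ValiantsHypothesis.Theorems.BarrierLeverPartitionMinorsHitByVPHiddenStatesCoStarAffine

/-!
# Route BarrierLever — item `PartitionMinorsHitByVP` (stmt-ValiantsHypothesis-19717), line `hidden-states`:
# the conjecture node at `r = 2^h − 2` for EVERY `h ≥ 2` — one co-star piece, all injective row families

Helper file (`--supports stmt-ValiantsHypothesis-19717`; cell valiant-natproofs, rung V4, 𝒟-side door (c); prover seat val-np-p6 gen 10).
Definition-free; closes NO item. Packages `CoStar.coStar_exists_table_pair` (`…CoStarAffine`) in the exact shape of the body of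
`Stmt.stub_universalJoinWide`: for `h ≥ 2` and `r = 2^h − 2`, the single legal strict-threshold piece «all state sets except the top and one
co-singleton» (K = h; weight 1 on the special state, 2 elsewhere) is good for EVERY injective `u : Fin r → Finset (Fin h)`
(`universalJoinWide_top_two`). With `CoStar.universalJoinWide_top` (p614189, `r = 2^h − 1`) these are the first two all-`h` cells of the node
served by ONE universal piece that is neither a tiling of the row family nor a cut certificate (dual Kronecker / Lagrange mechanism).

WHAT THIS IS NOT: the general CO-STAR conjecture (`c ≤ h+1` missing sets, all families) is open beyond affinely independent complements;
nothing on crux 14610 or VP ≠ VNP.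
-/

set_option linter.dupNamespace false

namespace Summit.ValiantsHypothesis.ValiantsHypothesis.Theorems.BarrierLever.HiddenStates

open Finset Matrix

noncomputable section

namespace CoStar

/-- **The conjecture node at `r = 2^h − 2`, for every `h ≥ 2`, with one piece.** -/
theorem universalJoinWide_top_two (h : ℕ) (h2 : 2 ≤ h) (r : ℕ) (hr : r + 2 = 2 ^ h) :
    ∃ (m K : ℕ) (W : Fin m → ℕ) (wt : Fin m → Fin K → ℕ) (e : Fin r → Fin m × Finset (Fin K)),
      m ≤ h + h ∧ K ≤ h * h * h ∧ Function.Injective e ∧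
      (∀ x : Fin m × Finset (Fin K), x ∉ Set.range e →
        ∀ i, W (e i).1 + ∑ k ∈ (e i).2, wt (e i).1 k < W x.1 + ∑ k ∈ x.2, wt x.1 k) ∧
      ∀ u : Fin r → Finset (Fin h), Function.Injective u →
        ∃ tx : Fin m → Option (Fin K) → Fin h → ℂ,
          (Matrix.of fun i k : Fin r =>
            ∏ a ∈ u i, (tx (e k).1 none a + ∑ q ∈ (e k).2, tx (e k).1 (some q) a)).det ≠ 0 := by
  classical
  have h1 : 1 ≤ h := by omega
  -- the special state
  let q₀ : Fin h := ⟨0, h1⟩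
  -- members: all subsets except `univ` and `univ.erase q₀`
  set D : Finset (Finset (Fin h)) := (Finset.univ.erase Finset.univ).erase (Finset.univ.erase q₀) with hD
  have hne : (Finset.univ : Finset (Fin h)).erase q₀ ≠ Finset.univ := by
    intro hh
    have := Finset.mem_univ q₀
    rw [← hh] at this
    exact Finset.notMem_erase q₀ _ this
  have hDcard : D.card = r := by
    rw [hD, Finset.card_erase_of_mem, Finset.card_erase_of_mem (Finset.mem_univ _), Finset.card_univ,
      Fintype.card_finset, Fintype.card_fin]
    · omega
    · rw [Finset.mem_erase]; exact ⟨hne, Finset.mem_univ _⟩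
  let ε : {x // x ∈ D} ≃ Fin r := (Finset.equivFin D).trans (finCongr hDcard)
  let c : Fin r → Finset (Fin h) := fun k => (ε.symm k).1
  have hc : Function.Injective c := fun k k' hkk => ε.symm.injective (Subtype.ext hkk)
  have hcmem : ∀ k, c k ∈ D := fun k => (ε.symm k).2
  have hcu : ∀ k, c k ≠ Finset.univ := by
    intro k hk
    have h2' := hcmem k
    rw [hD, Finset.mem_erase, Finset.mem_erase] at h2'
    exact h2'.2.1 hk
  have hcq : ∀ k, c k ≠ Finset.univ.erase q₀ := by
    intro k hk
    have h2' := hcmem k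
    rw [hD, Finset.mem_erase] at h2'
    exact h2'.1 hk
  have hcsurj : ∀ J, J ≠ Finset.univ → J ≠ Finset.univ.erase q₀ → ∃ k, c k = J := by
    intro J hJ hJ'
    have hJD : J ∈ D := by
      rw [hD, Finset.mem_erase, Finset.mem_erase]
      exact ⟨hJ', hJ, Finset.mem_univ _⟩
    exact ⟨ε ⟨J, hJD⟩, by simp [c]⟩
  -- weights: 1 on q₀, 2 elsewhere
  refine ⟨1, h, fun _ => 0, fun _ q => if q = q₀ then 1 else 2, fun k => ((0 : Fin 1), c k), by omega,
    le_trans (Nat.le_mul_of_pos_right h h1) (Nat.le_mul_of_pos_right _ h1), ?_, ?_, ?_⟩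
  · intro k k' hkk
    exact hc (congrArg Prod.snd hkk)
  · -- legality: members weigh ≤ 2h − 3, the two non-members weigh 2h − 2 and 2h − 1
    intro x hx i
    have hx2 : x.2 = Finset.univ ∨ x.2 = Finset.univ.erase q₀ := by
      by_contra hno
      push Not at hno
      obtain ⟨k, hk⟩ := hcsurj x.2 hno.1 hno.2
      apply hx
      refine ⟨k, ?_⟩
      ext1
      · exact Subsingleton.elim _ _
      · exact hk
    have hwt : ∀ J : Finset (Fin h), ∑ q ∈ J, (if q = q₀ then 1 else 2) + (if q₀ ∈ J then 1 else 0) = 2 * J.card := by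
      intro J
      by_cases hq : q₀ ∈ J
      · rw [if_pos hq, ← Finset.add_sum_erase J _ hq, if_pos rfl]
        rw [Finset.sum_congr rfl fun q hq' => if_neg (Finset.ne_of_mem_erase hq'), Finset.sum_const, smul_eq_mul,
          Finset.card_erase_of_mem hq]
        have := Finset.card_pos.mpr ⟨q₀, hq⟩
        omega
      · have hcongr : ∀ q ∈ J, (if q = q₀ then 1 else 2) = 2 := by
          intro q hq'
          rw [if_neg]
          rintro rfl
          exact hq hq'
        rw [if_neg hq, Finset.sum_congr rfl hcongr, Finset.sum_const, smul_eq_mul]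
        omega
    have hmem_wt : ∑ q ∈ c i, (if q = q₀ then 1 else 2) + 3 ≤ 2 * h := by
      have hlt : c i ⊂ Finset.univ := Finset.ssubset_univ_iff.mpr (hcu i)
      have hcard := Finset.card_lt_card hlt
      rw [Finset.card_univ, Fintype.card_fin] at hcard
      by_cases hsmall : (c i).card + 2 ≤ h
      · have := hwt (c i)
        by_cases hq : q₀ ∈ c i
        · rw [if_pos hq] at this; omega
        · rw [if_neg hq] at this; omega
      · have hcard' : (c i).card = h - 1 := by omega
        have hq : q₀ ∈ c i := by
          by_contra hq
          apply hcq i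
          apply Finset.eq_of_subset_of_card_le
          · intro y hy
            rw [Finset.mem_erase]
            exact ⟨fun hh => hq (hh ▸ hy), Finset.mem_univ _⟩
          · rw [Finset.card_erase_of_mem (Finset.mem_univ _), Finset.card_univ, Fintype.card_fin, hcard']
        have := hwt (c i)
        rw [if_pos hq] at this
        omega
    have hx_wt : 2 * h ≤ ∑ q ∈ x.2, (if q = q₀ then 1 else 2) + 2 := by
      rcases hx2 with hx2 | hx2
      · have := hwt x.2
        rw [hx2, if_pos (Finset.mem_univ _), Finset.card_univ, Fintype.card_fin] at this
        rw [hx2]; omega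
      · have := hwt x.2
        rw [hx2, if_neg (Finset.notMem_erase q₀ _), Finset.card_erase_of_mem (Finset.mem_univ _), Finset.card_univ,
          Fintype.card_fin] at this
        rw [hx2]; omega
    show 0 + ∑ q ∈ c i, (if q = q₀ then 1 else 2) < 0 + ∑ q ∈ x.2, (if q = q₀ then 1 else 2)
    omega
  · intro u hu
    exact coStar_exists_table_pair (0 : Fin 1) u hu hr c hc q₀ hcu hcq

end CoStar

end

end Summit.ValiantsHypothesis.ValiantsHypothesis.Theorems.BarrierLever.HiddenStates
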